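import Literature.AlgebraicGeometry.HodgeTheory.AbelianVarietyIsotypicComponentsUnique
import HarnessLib

/-!
# The isotypic profile of an abelian subvariety, of a finite cover and of a quotient is DOMINATED by that of `X`: the
# simple types occur among those of `X`, the multiplicities are at most those of `X`, the components map into the
# components — and an abelian subvariety with the full profile is all of `X` (Mumford §19 Cor. 1; Milne 1986 §12
# Prop. 12.1; Silverberg–Zarhin 2015 Lemma 3.1–3.3)

Layer `Literature/AlgebraicGeometry/HodgeTheory`; theorems only (no `def`, no instance, no named fact; net debt 0); PERFECT
field in §§2–3 (§§1, 4 hold over any field).  Sequel of `…IsotypicComponentsUnique` (and a sibling of `…IsotypicComponentsEndomorphisms`).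
An ISOTYPIC SYSTEM of `X` is the data of GEN 50's `exists_isotypicComponents_orthogonal`: pairwise non-isogenous simple
`B_q` (`0 < dim B_q`), abelian subvarieties `i_q : Y_q ↪ X` with `Y_q ∼ B_q^{n_q+1}` whose addition map is an isogeny; a
second abelian variety `Z` carries its own system (`C_p`, `m_p`, `k_p : W_p ↪ Z`).

THE PRINT.  Mumford §19 Cor. 1 of Thm. 1 (p. 173): `X ∼ ∏ X_i^{n_i}` with the `X_i` simple, pairwise non-isogenous, unique up to
isogeny; Milne 1986 §12 Prop. 12.1 p. 122 (PDF p. 189) «the `r_i` are uniquely determined and the `A_i` are uniquely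
determined up to isogeny»; Silverberg–Zarhin 2015 Lemma 3.1 (p. 5) «`Hom_F(A, B) ≠ 0` ⟺ … `A × B` is `F`-isotypic» (isotypic
types are detected by non-zero homomorphisms), Def. 2.3 ∕ 3.2 (isotypic components are maximal).  The domination statements
below are the standard consequences: a FINITE homomorphism `Z → X` (e.g. an abelian subvariety) or a SURJECTION `X ↠ Z`
transports every simple type of `Z` to a type of `X` (finite maps ∕ surjections from ∕ onto simple abelian varieties are
controlled by `…SimpleSubvarietiesOfDecomposition`), and the bound on multiplicities is `…IsotypicComponentsUnique`'s
`le_multiplicity_of_isFinite` (for quotients after a quasi-section, Milne Prop. 12.1's proof).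

Results (namespace `Literature.AlgebraicGeometry.HodgeTheory.AbelianVariety`):
* §1 (any field) `dim_eq_sum_of_isotypicSystem` (`dim X = Σ_q (n_q + 1) dim B_q` for an isotypic system), `isFinite_factor_comp`
  (the simple factor `C_p ↪ ⨁ C_p ∼ W_p ↪ Z → X` is finite over `X` when `Z → X` is);
* §2 finite `f : Z → X` (perfect field): **`existsUnique_type_of_isFinite`** (every type `C_p` of `Z` is isogenous to exactly
  one type `B_q` of `X`), **`multiplicity_le_of_isFinite`** (`C_p ∼ B_q ⟹ m_p ≤ n_q`), **`existsUnique_hom_comp_eq_of_isFinite`**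
  (the component `W_p` maps into `Y_q`: `g ≫ i_q = k_p ≫ f`, unique), `dim_component_le_of_isFinite`;
* §3 surjective `f : X ↠ Z`: `le_multiplicity_of_surjective` (`W ∼ B_q^{s+1}` a quotient of `X` ⟹ `s ≤ n_q`, by a quasi-section),
  **`existsUnique_type_of_surjective`**, **`multiplicity_le_of_surjective`**;
* §4 **`isIso_of_isClosedImmersion_of_profile_eq`** (an abelian subvariety `Z ↪ X` whose system has the same types and
  multiplicities as `X`'s, along a bijection of the index sets, is all of `X`: `dim Z = dim X`), `dim_le_dim_of_types`
  (`dim Z ≤ dim X` recovered through the profiles).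

## References
* [MumfordAV1970] D. Mumford, *Abelian Varieties* (1970), §19 Thm. 1, Cor. 1–2 and Remark p. 169 (pp. 169–174).
* [Milne1986AbelianVarieties] J. S. Milne, *Abelian Varieties*, in Cornell–Silverman (1986), §12 Prop. 12.1 and its proof, p. 122
  (PDF p. 189); §8 Prop. 8.1, Thm. 8.2 (PDF pp. 180–181).
* [SilverbergZarhin2015] A. Silverberg, Yu. G. Zarhin, *Isogenies of abelian varieties over finite fields*, Des. Codes Cryptogr.
  77 (2015) (arXiv:1409.0592), Def. 2.2–2.3, Lemma 3.1, Def. 3.2, Lemma 3.3 (pp. 3, 5).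
* [LangeRodriguez2022] H. Lange, R. E. Rodríguez, LNM 2310 (2022), Thm. 2.7.1 (PDF p. 38).
-/

noncomputable section

universe u

open CategoryTheory CategoryTheory.Limits

namespace Literature.AlgebraicGeometry.HodgeTheory

namespace AbelianVariety

open _root_.AlgebraicGeometry
open Literature.AlgebraicGeometry.Motives Literature.AlgebraicGeometry.Motives.AbelianVariety

variable {K : Type u} [Field K]

/-! ## §1 Bookkeeping (any field) -/

section AnyField

variable {Q : Type} [Fintype Q] {B : Q → Motives.AbelianVariety K} {n : Q → ℕ} {X Z : Motives.AbelianVariety K}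
  {Y : Q → Motives.AbelianVariety K}

/-- **`dim X = Σ_q (n_q + 1) · dim B_q`** for an isotypic system (`Y_q ∼ B_q^{n_q+1}`, addition map `⨁ Y_q → X` an isogeny).
[cite: MumfordAV1970, §19 Cor. 1 of Thm. 1 (p. 173)] [cite: Milne1986AbelianVarieties, §12 Prop. 12.1 (PDF p. 189)] -/
theorem dim_eq_sum_of_isotypicSystem (hY : ∀ q, IsIsogenous (Y q) (⨁ fun _ : Fin (n q + 1) ↦ B q))
    (i : ∀ q, Y q ⟶ X) (hdesc : IsIsogeny (biproduct.desc i)) : X.dim = ∑ q, (n q + 1) * (B q).dim := by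
  rw [← dim_eq_of_isIsogeny hdesc, dim_biproduct]
  exact Finset.sum_congr rfl fun q _ ↦ by rw [(hY q).dim_eq, dim_biproduct_const, Fintype.card_fin]

/-- The simple factor `C ↪ C^{m+1} ∼ W → Z → X` of a component `W ∼ C^{m+1}` of `Z` is FINITE over `X` when `k : W → Z` and
`f : Z → X` are: precisely, for an isogeny `e : ⨁_{m+1} C → W`, `ι_0 ≫ e ≫ k ≫ f` is finite. [cite: Milne1986AbelianVarieties, §8 Prop. 8.1 (PDF p. 180)]
[cite: MumfordAV1970, §19 Thm. 1 (p. 173)] -/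
theorem isFinite_factor_comp {C W : Motives.AbelianVariety K} {m : ℕ} {e : (⨁ fun _ : Fin (m + 1) ↦ C) ⟶ W}
    (he : IsIsogeny e) (k : W ⟶ Z) [IsFinite (Hom.toSchemeHom k)] (f : Z ⟶ X) [IsFinite (Hom.toSchemeHom f)] :
    IsFinite (Hom.toSchemeHom (biproduct.ι (fun _ : Fin (m + 1) ↦ C) 0 ≫ e ≫ k ≫ f)) := by
  classical
  haveI := isFinite_toSchemeHom_biproduct_ι (fun _ : Fin (m + 1) ↦ C) 0
  haveI : IsFinite (Hom.toSchemeHom e) := he.2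
  haveI := isFinite_toSchemeHom_comp k f
  haveI := isFinite_toSchemeHom_comp e (k ≫ f)
  exact isFinite_toSchemeHom_comp _ _

end AnyField

/-! ## §2 Finite homomorphisms `Z → X` (abelian subvarieties, finite covers): types and multiplicities are dominated -/

section Finite

variable [PerfectField K] {Q P : Type} [Fintype Q] {B : Q → Motives.AbelianVariety K} {n : Q → ℕ}
  {C : P → Motives.AbelianVariety K} {m : P → ℕ} {X Z : Motives.AbelianVariety K} {Y : Q → Motives.AbelianVariety K}
  {W : P → Motives.AbelianVariety K}

/-- **Every simple type of `Z` occurs in `X`** when there is a FINITE homomorphism `f : Z → X` (e.g. `Z` an abelian subvariety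
of `X`): each `C_p` is isogenous to exactly one `B_q`. [cite: MumfordAV1970, §19 Cor. 1 of Thm. 1 (p. 173)]
[cite: Milne1986AbelianVarieties, §12 Prop. 12.1 (PDF p. 189)] [cite: SilverbergZarhin2015, Lemma 3.1 (p. 5)] -/
theorem existsUnique_type_of_isFinite (hB : ∀ q, (B q).IsSimple) (hni : ∀ q q', q ≠ q' → ¬ IsIsogenous (B q) (B q'))
    (hX : IsIsogenous X (⨁ fun q ↦ ⨁ fun _ : Fin (n q + 1) ↦ B q)) (hC : ∀ p, (C p).IsSimple) (hC0 : ∀ p, 0 < (C p).dim)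
    (hW : ∀ p, IsIsogenous (W p) (⨁ fun _ : Fin (m p + 1) ↦ C p)) (k : ∀ p, W p ⟶ Z)
    (hk : ∀ p, IsClosedImmersion (Hom.toSchemeHom (k p))) (f : Z ⟶ X) [IsFinite (Hom.toSchemeHom f)] (p : P) :
    ∃! q, IsIsogenous (C p) (B q) := by
  obtain ⟨e, he⟩ := (hW p).symm'
  haveI := hk p
  haveI := isFinite_factor_comp he (k p) f
  exact existsUnique_isIsogenous_of_isFinite hB hni hX (hC p) (hC0 p) (biproduct.ι (fun _ : Fin (m p + 1) ↦ C p) 0 ≫ e ≫ k p ≫ f)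

/-- **Multiplicities are dominated**: if `C_p ∼ B_q` then `m_p ≤ n_q` (a finite homomorphism `Z → X` restricts to a finite
homomorphism `W_p → X` from `W_p ∼ B_q^{m_p+1}`). [cite: Milne1986AbelianVarieties, §12 Prop. 12.1 (PDF p. 189)]
[cite: MumfordAV1970, §19 Cor. 1 of Thm. 1 (p. 173)] [cite: SilverbergZarhin2015, Def. 2.3 and proof of Lemma 3.3 (p. 5)] -/
theorem multiplicity_le_of_isFinite (hB : ∀ q, (B q).IsSimple) (hB0 : ∀ q, 0 < (B q).dim)
    (hni : ∀ q q', q ≠ q' → ¬ IsIsogenous (B q) (B q')) (hY : ∀ q, IsIsogenous (Y q) (⨁ fun _ : Fin (n q + 1) ↦ B q))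
    (i : ∀ q, Y q ⟶ X) (hi : ∀ q, IsClosedImmersion (Hom.toSchemeHom (i q))) (hdesc : IsIsogeny (biproduct.desc i))
    (hW : ∀ p, IsIsogenous (W p) (⨁ fun _ : Fin (m p + 1) ↦ C p)) (k : ∀ p, W p ⟶ Z)
    (hk : ∀ p, IsClosedImmersion (Hom.toSchemeHom (k p))) (f : Z ⟶ X) [IsFinite (Hom.toSchemeHom f)] {p : P} {q : Q}
    (hpq : IsIsogenous (C p) (B q)) : m p ≤ n q := by
  obtain ⟨e, he⟩ := exists_isIsogeny_biproduct_map_of_isIsogenous (F := fun _ : Fin (m p + 1) ↦ C p)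
    (G := fun _ : Fin (m p + 1) ↦ B q) fun _ ↦ hpq
  haveI := hk p
  haveI : IsFinite (Hom.toSchemeHom (k p ≫ f)) := isFinite_toSchemeHom_comp (k p) f
  exact le_multiplicity_of_isFinite hB hB0 hni hY i hi hdesc ((hW p).trans ⟨_, he⟩) (k p ≫ f)

/-- **The components map into the components**: if `C_p ∼ B_q` then `k_p ≫ f` factors UNIQUELY through `i_q : Y_q ↪ X`.
[cite: SilverbergZarhin2015, Def. 2.3 and proof of Lemma 3.3 (p. 5)] [cite: MumfordAV1970, §19 Cor. 2 of Thm. 1 (p. 174)] -/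
theorem existsUnique_hom_comp_eq_of_isFinite (hB : ∀ q, (B q).IsSimple) (hB0 : ∀ q, 0 < (B q).dim)
    (hni : ∀ q q', q ≠ q' → ¬ IsIsogenous (B q) (B q')) (hY : ∀ q, IsIsogenous (Y q) (⨁ fun _ : Fin (n q + 1) ↦ B q))
    (i : ∀ q, Y q ⟶ X) (hi : ∀ q, IsClosedImmersion (Hom.toSchemeHom (i q))) (hdesc : IsIsogeny (biproduct.desc i))
    (hW : ∀ p, IsIsogenous (W p) (⨁ fun _ : Fin (m p + 1) ↦ C p)) (k : ∀ p, W p ⟶ Z) (f : Z ⟶ X) {p : P} {q : Q}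
    (hpq : IsIsogenous (C p) (B q)) : ∃! g : W p ⟶ Y q, g ≫ i q = k p ≫ f := by
  obtain ⟨e, he⟩ := exists_isIsogeny_biproduct_map_of_isIsogenous (F := fun _ : Fin (m p + 1) ↦ C p)
    (G := fun _ : Fin (m p + 1) ↦ B q) fun _ ↦ hpq
  exact existsUnique_hom_comp_isotypicComponent_eq hB hB0 hni hY i hi hdesc ((hW p).trans ⟨_, he⟩) (k p ≫ f)

/-- `dim W_p ≤ dim Y_q` when `C_p ∼ B_q` and `Z → X` is finite. [cite: Milne1986AbelianVarieties, §8 Prop. 8.1 (PDF p. 180) and §12 Prop. 12.1 (PDF p. 189)] -/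
theorem dim_component_le_of_isFinite (hB : ∀ q, (B q).IsSimple) (hB0 : ∀ q, 0 < (B q).dim)
    (hni : ∀ q q', q ≠ q' → ¬ IsIsogenous (B q) (B q')) (hY : ∀ q, IsIsogenous (Y q) (⨁ fun _ : Fin (n q + 1) ↦ B q))
    (i : ∀ q, Y q ⟶ X) (hi : ∀ q, IsClosedImmersion (Hom.toSchemeHom (i q))) (hdesc : IsIsogeny (biproduct.desc i))
    (hW : ∀ p, IsIsogenous (W p) (⨁ fun _ : Fin (m p + 1) ↦ C p)) (k : ∀ p, W p ⟶ Z)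
    (hk : ∀ p, IsClosedImmersion (Hom.toSchemeHom (k p))) (f : Z ⟶ X) [IsFinite (Hom.toSchemeHom f)] {p : P} {q : Q}
    (hpq : IsIsogenous (C p) (B q)) : (W p).dim ≤ (Y q).dim := by
  obtain ⟨e, he⟩ := exists_isIsogeny_biproduct_map_of_isIsogenous (F := fun _ : Fin (m p + 1) ↦ C p)
    (G := fun _ : Fin (m p + 1) ↦ B q) fun _ ↦ hpq
  haveI := hk p
  haveI : IsFinite (Hom.toSchemeHom (k p ≫ f)) := isFinite_toSchemeHom_comp (k p) f
  exact dim_le_dim_isotypicComponent_of_isFinite hB hB0 hni hY i hi hdesc ((hW p).trans ⟨_, he⟩) (k p ≫ f)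

end Finite

/-! ## §3 Surjections `X ↠ Z`: types and multiplicities of the quotient are dominated -/

section Surjective

variable [PerfectField K] {Q P : Type} [Fintype Q] [Fintype P] {B : Q → Motives.AbelianVariety K} {n : Q → ℕ}
  {C : P → Motives.AbelianVariety K} {m : P → ℕ} {X Z V : Motives.AbelianVariety K} {Y : Q → Motives.AbelianVariety K}
  {W : P → Motives.AbelianVariety K}

/-- **`V ∼ B_q^{s+1}` a QUOTIENT of `X` ⟹ `s ≤ n_q`**: a surjection `h : X ↠ V` has a quasi-section `t : V → X`,
`t ≫ h = N • 𝟙` (perfect field), which is finite; then `le_multiplicity_of_isFinite`.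
[cite: Milne1986AbelianVarieties, §12 Prop. 12.1 and its proof (PDF p. 189)] [cite: MumfordAV1970, §19 Thm. 1 and Remark p. 169] -/
theorem le_multiplicity_of_surjective (hB : ∀ q, (B q).IsSimple) (hB0 : ∀ q, 0 < (B q).dim)
    (hni : ∀ q q', q ≠ q' → ¬ IsIsogenous (B q) (B q')) (hY : ∀ q, IsIsogenous (Y q) (⨁ fun _ : Fin (n q + 1) ↦ B q))
    (i : ∀ q, Y q ⟶ X) (hi : ∀ q, IsClosedImmersion (Hom.toSchemeHom (i q))) (hdesc : IsIsogeny (biproduct.desc i))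
    {q : Q} {s : ℕ} (hV : IsIsogenous V (⨁ fun _ : Fin (s + 1) ↦ B q)) (h : X ⟶ V) [Surjective (Hom.toSchemeHom h)] :
    s ≤ n q := by
  obtain ⟨t, N, hN, ht⟩ := exists_quasiSection_of_perfectField h
  haveI : IsFinite (Hom.toSchemeHom t) := isFinite_of_comp_eq_nsmul_id hN ht
  exact le_multiplicity_of_isFinite hB hB0 hni hY i hi hdesc hV t

/-- **Every simple type of a quotient `X ↠ Z` occurs in `X`**: each `C_p` is isogenous to exactly one `B_q` (`X ↠ Z ↠ C_p`).
[cite: MumfordAV1970, §19 Cor. 1 of Thm. 1 (p. 173)] [cite: Milne1986AbelianVarieties, §12 Prop. 12.1 (PDF p. 189)] -/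
theorem existsUnique_type_of_surjective (hB : ∀ q, (B q).IsSimple) (hni : ∀ q q', q ≠ q' → ¬ IsIsogenous (B q) (B q'))
    (hX : IsIsogenous X (⨁ fun q ↦ ⨁ fun _ : Fin (n q + 1) ↦ B q)) (hC : ∀ p, (C p).IsSimple) (hC0 : ∀ p, 0 < (C p).dim)
    (hZ : IsIsogenous Z (⨁ fun p ↦ ⨁ fun _ : Fin (m p + 1) ↦ C p)) (f : X ⟶ Z) [Surjective (Hom.toSchemeHom f)]
    (p : P) : ∃! q, IsIsogenous (C p) (B q) := by
  obtain ⟨g, hg⟩ := exists_surjective_hom_factor hZ p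
  haveI := hg
  haveI : Surjective (Hom.toSchemeHom (f ≫ g)) := by
    change Surjective (Hom.toSchemeHom f ≫ Hom.toSchemeHom g)
    infer_instance
  exact existsUnique_isIsogenous_of_surjective hB hni hX (hC p) (hC0 p) (f ≫ g)

/-- **Multiplicities of a quotient are dominated**: for `X ↠ Z` with isotypic systems and `C_p ∼ B_q`, `m_p ≤ n_q`
(`X ↠ Z ↠ W_p ∼ B_q^{m_p+1}`, the second map a factor projection of `Z ∼ ⨁_p W_p`).
[cite: Milne1986AbelianVarieties, §12 Prop. 12.1 and its proof (PDF p. 189)] [cite: MumfordAV1970, §19 Cor. 1 of Thm. 1 (p. 173)] -/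
theorem multiplicity_le_of_surjective (hB : ∀ q, (B q).IsSimple) (hB0 : ∀ q, 0 < (B q).dim)
    (hni : ∀ q q', q ≠ q' → ¬ IsIsogenous (B q) (B q')) (hY : ∀ q, IsIsogenous (Y q) (⨁ fun _ : Fin (n q + 1) ↦ B q))
    (i : ∀ q, Y q ⟶ X) (hi : ∀ q, IsClosedImmersion (Hom.toSchemeHom (i q))) (hdesc : IsIsogeny (biproduct.desc i))
    (hW : ∀ p, IsIsogenous (W p) (⨁ fun _ : Fin (m p + 1) ↦ C p)) (k : ∀ p, W p ⟶ Z) (hdescZ : IsIsogeny (biproduct.desc k))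
    (f : X ⟶ Z) [Surjective (Hom.toSchemeHom f)] {p : P} {q : Q} (hpq : IsIsogenous (C p) (B q)) : m p ≤ n q := by
  have hZ : IsIsogenous Z (⨁ W) := IsIsogenous.symm' ⟨_, hdescZ⟩
  obtain ⟨g, hg⟩ := exists_surjective_hom_summand hZ p
  haveI := hg
  haveI : Surjective (Hom.toSchemeHom (f ≫ g)) := by
    change Surjective (Hom.toSchemeHom f ≫ Hom.toSchemeHom g)
    infer_instance
  obtain ⟨e, he⟩ := exists_isIsogeny_biproduct_map_of_isIsogenous (F := fun _ : Fin (m p + 1) ↦ C p)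
    (G := fun _ : Fin (m p + 1) ↦ B q) fun _ ↦ hpq
  exact le_multiplicity_of_surjective hB hB0 hni hY i hi hdesc ((hW p).trans ⟨_, he⟩) (f ≫ g)

end Surjective

/-! ## §4 An abelian subvariety with the full isotypic profile is everything (any field) -/

section Full

variable {Q P : Type} [Fintype Q] [Fintype P] {B : Q → Motives.AbelianVariety K} {n : Q → ℕ}
  {C : P → Motives.AbelianVariety K} {m : P → ℕ} {X Z : Motives.AbelianVariety K} {Y : Q → Motives.AbelianVariety K}
  {W : P → Motives.AbelianVariety K}

/-- `dim Z ≤ dim X` read off the profiles: if every type of `Z` matches a type of `X` along an injection `σ` with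
`C_p ∼ B_{σ p}` and `m_p ≤ n_{σ p}`, then `Σ_p (m_p+1) dim C_p ≤ Σ_q (n_q+1) dim B_q` (any field).
[cite: Milne1986AbelianVarieties, §12 Prop. 12.1 (PDF p. 189)] [cite: MumfordAV1970, §19 Cor. 1 of Thm. 1 (p. 173)] -/
theorem dim_le_dim_of_types (hY : ∀ q, IsIsogenous (Y q) (⨁ fun _ : Fin (n q + 1) ↦ B q)) (i : ∀ q, Y q ⟶ X)
    (hdesc : IsIsogeny (biproduct.desc i)) (hW : ∀ p, IsIsogenous (W p) (⨁ fun _ : Fin (m p + 1) ↦ C p))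
    (k : ∀ p, W p ⟶ Z) (hdescZ : IsIsogeny (biproduct.desc k)) (σ : P → Q) (hσ : Function.Injective σ)
    (hCB : ∀ p, IsIsogenous (C p) (B (σ p))) (hmn : ∀ p, m p ≤ n (σ p)) : Z.dim ≤ X.dim := by
  classical
  rw [dim_eq_sum_of_isotypicSystem hY i hdesc, dim_eq_sum_of_isotypicSystem hW k hdescZ]
  calc ∑ p, (m p + 1) * (C p).dim ≤ ∑ p, (n (σ p) + 1) * (B (σ p)).dim :=
        Finset.sum_le_sum fun p _ ↦ by
          rw [(hCB p).dim_eq]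
          exact Nat.mul_le_mul_right _ (Nat.succ_le_succ (hmn p))
    _ = ∑ q ∈ Finset.univ.image σ, (n q + 1) * (B q).dim := by
        rw [Finset.sum_image fun p _ p' _ h ↦ hσ h]
    _ ≤ ∑ q, (n q + 1) * (B q).dim :=
        Finset.sum_le_sum_of_subset_of_nonneg (Finset.subset_univ _) fun _ _ _ ↦ Nat.zero_le _

/-- **An abelian subvariety with the FULL isotypic profile is all of `X`**: if `j : Z ↪ X` is an abelian subvariety whose
isotypic system matches that of `X` along a bijection `σ` of the types (`C_p ∼ B_{σ p}`) with EQUAL multiplicities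
`m_p = n_{σ p}`, then `j` is an isomorphism (`dim Z = dim X`). [cite: Milne1986AbelianVarieties, §12 Prop. 12.1 (PDF p. 189)]
[cite: GortzWedhorn2023, proof of Prop. 27.176 (iii) ⟹ (iv) (PDF p. 882)] [cite: MumfordAV1970, §19 Cor. 1 of Thm. 1 (p. 173)] -/
theorem isIso_of_isClosedImmersion_of_profile_eq (hY : ∀ q, IsIsogenous (Y q) (⨁ fun _ : Fin (n q + 1) ↦ B q))
    (i : ∀ q, Y q ⟶ X) (hdesc : IsIsogeny (biproduct.desc i)) (hW : ∀ p, IsIsogenous (W p) (⨁ fun _ : Fin (m p + 1) ↦ C p))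
    (k : ∀ p, W p ⟶ Z) (hdescZ : IsIsogeny (biproduct.desc k)) (σ : P ≃ Q) (hCB : ∀ p, IsIsogenous (C p) (B (σ p)))
    (hmn : ∀ p, m p = n (σ p)) (j : Z ⟶ X) [IsClosedImmersion (Hom.toSchemeHom j)] : IsIso j := by
  refine isIso_of_isClosedImmersion_of_dim_eq j ?_
  rw [dim_eq_sum_of_isotypicSystem hY i hdesc, dim_eq_sum_of_isotypicSystem hW k hdescZ,
    ← Equiv.sum_comp σ (fun q ↦ (n q + 1) * (B q).dim)]
  exact Finset.sum_congr rfl fun p _ ↦ by rw [(hCB p).dim_eq, hmn p]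

end Full

end AbelianVariety

end Literature.AlgebraicGeometry.HodgeTheory

end
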